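import Summits.QuantumFields.YangMills.Theorems.BalabanUVNodesN08AlphaEq324RowClassSocketEndUnitRange
import Literature.MathematicalPhysics.QuantumFieldTheory.Balaban1983to89.B1Eq324BenfattoClassTorusWindow

/-!
# Route «BalabanUVNodes», Track-A DAG node N08 = [Balaban1985UV3] Thm 1 p. 257 ∕ Thm 2 p. 272 — THE CLASS ROAD ∘ THE (α)-SOCKET IN INDEX AND TORUS LETTERS:
# the (3.24) row `h324` of the edited clauses at EVERY run step for an a.e. presentation of the step block by the Gaussian `𝒩(0, T⁻¹)` of the block's OWN
# finitely many variables — precision `T` symmetric, `γ_A`-coercive, decaying in ANY pseudo-distance that a bijection onto a window of `ℤ^{d′}` distorts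
# one-sidedly (§2), in particular in the TORUS metric of [Balaban1985UV3]'s unit lattice via seat n08-b's bent window (§3) (part 8 of the class socket)

Cell `pub-ymgap`, seat `pub-ymgap-dag-n08-w4` gen 6 (CLAIM-3 ∕ INTENT-3, INBOX l.40431).  `bears_on: R4∕N08`; filed `--supports stmt-QuantumFields-27364` (K1⁹, helper).  THEOREMS ONLY
(def-free, sorry-free, standard axioms); part 7 (`…ClassSocketEndUnitRange.exists_threshold_h324Row_freeLetter_of_expDecayPresentation_allSteps_ae`, p642420) and seat
n08-b's presentation kit (`…ClassPresentation`: `reindex_symm ∕ reindex_coercive ∕ reindex_abs_le_exp_of_dist_le ∕ map_restrictAlong_eq ∕ preimage_box_ae_eq_smallFieldSet`,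
p638070; `…ClassTorusWindow.exists_presentation_of_torusDecay`, p639605) consumed BY NAME.

WHY.  Parts 5–7 read the member through a window `Λ h U ⊂ ℤ^d` and its precision `A h U : Matrix Λ Λ ℝ`, and present the block by `μ_K` on `ℤ^d → ℝ`.  [Balaban1985UV3]'s
fluctuation Gaussian `dμ_{C^{(k)}}` ((22) p.261, (58) p.270) lives on its OWN finite set of variables — bonds of `Ω_{k+1}(h) ⊂ T₁^{(k)}` (a TORUS) × `su(N)` components —
with the quadratic form `⟨A, C*Δ_kCA⟩` (p.271) whose bounds N06 ([Balaban1985BackgroundPropagators] Sect. E) states in the TORUS metric; seat n08-b typed the re-indexing and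
the bent window Literature-side (gen 5's CHECK A ∕ CHECK C).  This part moves the socket's mouth to those letters, Summits-side, so that the IDENT (NODE 00's `(𝔖 k).μ ∕ box ∕ 𝒱`)
meets `h324` with NO window bookkeeping left: the member rows are stated for `T` on the block's index set `B h U` (any ambient index type), the presentation for
`𝒩(0, T⁻¹)` on `B h U → ℝ` (`(𝔖 k).μ = 𝒩(0,T⁻¹).map Φ`, box `Φ⁻¹'χ =ᵐ {|ω_b| ≤ p(g_k) ∀ b}`, potential `𝒱 ∘ Φ =ᵐ H`), and ONLY the Hamiltonian letters stay on the window
(`H (z ∘ e) = H^a_J z`, `J ⊆ Λ`, `sup|coeff| ≤ c₀ g_k^σ` — the class-II content the kit also leaves there).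
* §1 `preimage_box_ae_eq_smallFieldSet_of_nonneg` ∕ `_all` — a box identity for thresholds `p ≥ 0` holds for EVERY real `p` (both sides empty when `p < 0`;
  the END's `b₀` is universal, so `p(g_k)` has no sign), and the kit's identity in that form.
* §2 ★★★ `exists_threshold_h324Row_freeLetter_of_indexedPresentation_allSteps_ae` — INDEX LETTERS: scalars `(γ_A, K_T, κ_T, C₁, C₀)`; rows `T` symmetric, `γ_A`-coercive,
  `|T b b′| ≤ K_T e^{−κ_T ρ(b,b′)}`, a bijection `e h U : B h U ≃ Λ h U ⊂ ℤ^d` with `|e b − e b′|₂ ≤ C₁ρ + C₀`; presentation + Hamiltonian rows as above; volume `|Λ| ≤ v·|T₁^{(k)}|`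
  ⟹ `h324` at the free letter, every `k ≤ K`, window `b₁ < b₀` (`b₁` from the class scalars with `K_A = K_T e^{κ_T C₀∕C₁}`, `κ_A = κ_T∕C₁`).
* §3 ★★★ `exists_threshold_h324Row_freeLetter_of_torusBlockPresentation_allSteps_ae` — TORUS LETTERS: variables placed on `(ℤ∕N)^{d_T}` with labels (`(site, lab)` injective),
  decay in any `ρ` dominating the torus sup-distance ⟹ `∃ (Λ, e)` on the bent window `ℤ^{2d_T+1}` (CHOSEN per `(h, U)` by the kit) such that every presentation as above gives `h324`
  (`K_A = K_T e^{κ_T m}`, `κ_A = κ_T∕√(2d_T+1)`).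
A6 (№189).  The binder lists of §2 ∕ §3 are inhabited — e.g. by the one-variable block (`B = {⋆}`, `T = γ_A·1`, `ρ = 0`, `e : {⋆} ≃ {0}`, zero Hamiltonian letters), which §2 maps to
the one-site datum of `…ClassSocketEndInhabited` (p645090, where part 7's own list is certified); not re-typed here.
HONEST SCOPE.  Compositions by name (two `obtain`s, one `choose`, `Measure.map_map`, `QuasiMeasurePreserving.preimage_ae_eq`, `ae_eq_comp`); member ∕ presentation ∕ Hamiltonian
letters ∕ window ∕ budget are HYPOTHESES (IDENT = NODE 00 objects + N06 in-edges, NOT commissioned, NOT claimed); nothing of [Balaban1985UV3] ∕ [BenfattoEtAl1978] ∕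
[Balaban1985BackgroundPropagators] asserted or discharged; `PrintedUV3V` NOT proved; N08 NOT discharged; count-neutral; one finite 𝕋⁴ programme at fixed ε — R4 closes the
conditional finite-𝕋⁴ rung `BalabanLadder.UV` only; nothing continuum ∕ ℝ⁴ ∕ OS ∕ mass gap ∕ Clay.
-/

noncomputable section

namespace Summit.QuantumFields.YangMills.Theorems.BalabanUVNodesN08AlphaEq324RowClassSocketEndIndexed

open MeasureTheory
open scoped BigOperators Nat
open Literature.MathematicalPhysics.QuantumFieldTheory (gaussianFieldOfKernel)
open Literature.MathematicalPhysics.QuantumFieldTheory.Balaban1983to89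
open Literature.MathematicalPhysics.QuantumFieldTheory.Balaban1983to89.B1Sect3Statements (Eq324)
open Literature.MathematicalPhysics.QuantumFieldTheory.Balaban1983to89.B1Eq324BenfattoLemma (Coef hamiltonian coefSup smallFieldSet distToRegion)
open Literature.MathematicalPhysics.QuantumFieldTheory.Balaban1983to89.B1Eq324BenfattoAppendixA (distToRegion_nonneg)
open Literature.MathematicalPhysics.QuantumFieldTheory.Balaban1983to89.B1Eq324BenfattoClassPresentation
  (reindex_symm reindex_coercive reindex_abs_le_exp_of_dist_le map_restrictAlong_eq preimage_box_ae_eq_smallFieldSet measurable_restrictAlong)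
open Literature.MathematicalPhysics.QuantumFieldTheory.Balaban1983to89.B1Eq324BenfattoClassTorusWindow (exists_presentation_of_torusDecay)
open Literature.MathematicalPhysics.QuantumFieldTheory.Balaban1985CMP102.Setting
open Summit.QuantumFields.Balaban3D.Carriers
open Summit.QuantumFields.Balaban3D.Proofs.ScalesArithmetic (gk_pos gk_le_one)
open Summit.QuantumFields.Balaban3D.Proofs.Primitives (AlphaConsts)
open Summit.QuantumFields.Balaban3D.Proofs.GroupModelLieC (lieC)
open Summit.QuantumFields.YangMills.Theorems.BalabanUVNodesN08AlphaEq324RowClassSocketEndUnitRange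
  (exists_threshold_h324Row_freeLetter_of_expDecayPresentation_allSteps_ae)
open Literature.Probability.LatticeModels (cumulantOf)

variable {d : ℕ}

/-! ## §1 The a.e. box identity for every real threshold -/

/-- A box identity stated for non-negative thresholds extends to EVERY real threshold: for `p < 0` both the uniform box `{|ω_b| ≤ p ∀ b}` (on a nonempty
index set) and `smallFieldSet Λ p` are empty, whatever the measure. [cite: BenfattoEtAl1978, p.152 and (A.1) p.161 (class form; ours)] -/
theorem preimage_box_ae_eq_smallFieldSet_of_nonneg {β : Type} [Nonempty β] {Λ : Finset (Fin d → ℤ)} (e : β ≃ ↥Λ) (μ : Measure ((Fin d → ℤ) → ℝ))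
    (hkit : ∀ p : ℝ, 0 ≤ p →
      ((fun (z : (Fin d → ℤ) → ℝ) (b : β) => z ((e b : ↥Λ) : Fin d → ℤ)) ⁻¹' {ω : β → ℝ | ∀ b, |ω b| ≤ p}) =ᵐ[μ] smallFieldSet Λ p) (p : ℝ) :
    ((fun (z : (Fin d → ℤ) → ℝ) (b : β) => z ((e b : ↥Λ) : Fin d → ℤ)) ⁻¹' {ω : β → ℝ | ∀ b, |ω b| ≤ p}) =ᵐ[μ] smallFieldSet Λ p := by
  rcases le_or_gt 0 p with hp | hp
  · exact hkit p hp
  · have h1 : {ω : β → ℝ | ∀ b, |ω b| ≤ p} = ∅ :=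
      Set.eq_empty_of_forall_notMem fun ω (hω : ∀ b, |ω b| ≤ p) => by
        linarith [hω (Classical.arbitrary β), abs_nonneg (ω (Classical.arbitrary β))]
    have h2 : smallFieldSet Λ p = ∅ := Set.eq_empty_of_forall_notMem fun z (hz : ∀ x, |z x| ≤ p * (1 + distToRegion Λ x)) => by
      have hz0 : |z 0| ≤ p * (1 + distToRegion Λ 0) := hz 0
      have hdist : 0 ≤ distToRegion Λ 0 := distToRegion_nonneg _ _
      nlinarith [abs_nonneg (z 0)]
    rw [h1, Set.preimage_empty, h2]

/-- Seat n08-b's `preimage_box_ae_eq_smallFieldSet` (for `μ_K`, `K` the zero-extended inverse of the re-indexed precision) for EVERY real threshold `p`.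
[cite: BenfattoEtAl1978, p.152 and (A.1) p.161 (class form; ours)] -/
theorem preimage_box_ae_eq_smallFieldSet_all {β : Type} [Fintype β] [DecidableEq β] [Nonempty β] {Λ : Finset (Fin d → ℤ)} (e : β ≃ ↥Λ)
    {T : Matrix β β ℝ} (hTs : ∀ b b', T b b' = T b' b) {γ : ℝ} (hγ0 : 0 < γ)
    (hγ : ∀ v : β → ℝ, γ * ∑ b, v b ^ 2 ≤ ∑ b, ∑ b', T b b' * v b * v b') (p : ℝ) :
    ((fun (z : (Fin d → ℤ) → ℝ) (b : β) => z ((e b : ↥Λ) : Fin d → ℤ)) ⁻¹' {ω : β → ℝ | ∀ b, |ω b| ≤ p})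
      =ᵐ[gaussianFieldOfKernel fun x y => if hxy : x ∈ Λ ∧ y ∈ Λ then
          ((Matrix.reindex e e T)⁻¹ : Matrix ↥Λ ↥Λ ℝ) ⟨x, hxy.1⟩ ⟨y, hxy.2⟩ else 0] smallFieldSet Λ p :=
  preimage_box_ae_eq_smallFieldSet_of_nonneg e _ (fun _ hq => preimage_box_ae_eq_smallFieldSet e (fun _ _ => rfl) hTs hγ0 hγ hq) p

variable {L : ℕ} {G : Type} [GaugeGroup G] [MeasurableSpace G] [HaarData G] (𝔊 : GroupModel G) (𝔠 : AlphaConsts L 𝔊.N)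

/-! ## §2 INDEX LETTERS: the block's own variables, a precision on them, a bijection onto a window -/

/-- ★★★ **THE (3.24) ROW AT EVERY RUN STEP FROM A PRESENTATION BY `𝒩(0, T⁻¹)` ON THE BLOCK's OWN VARIABLES.**  Scalars `γ_A > 0`, `K_T ≥ 0`, `κ_T > 0`, `C₁ > 0`, `C₀`,
Hamiltonian shape `(D, ϰ > 0)`, `p₀ > 2∕3`, `σ > 0`, `c₀ ≥ 0`, `6 + 2κ₀ < σ(n̄ + 1)`: `∃ b₁, ∀ b₀ > b₁, ∃ C ≥ 0, ∀ S 𝔖, ∀ k ≤ K, ∀ v` with `C·v ≤ Ca + Cc`, for every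
per-(h,U) index set `B h U` (a `Finset` of any type), precision `T h U` (symmetric, `γ_A`-coercive, `|T b b′| ≤ K_T e^{−κ_T ρ(b,b′)}`), bijection `e h U : B h U ≃ Λ h U ⊂ ℤ^d`
with `|e b − e b′|₂ ≤ C₁ρ(b,b′) + C₀`, measurable `Φ h U : (B h U → ℝ) → Fl` with `(𝔖 k).μ = 𝒩(0,T⁻¹).map Φ`, `Φ⁻¹'box =ᵐ {|ω_b| ≤ p(g_k) ∀ b}`, `𝒱 ∘ Φ =ᵐ H`, Hamiltonian
letters `H (z ∘ e) = H^a_J z` (`J ⊆ Λ`, `sup|coeff| ≤ c₀ g_k^σ`) and `|Λ| ≤ v·|T₁^{(k)}|`: the row `StepAlphaEq324CoreLTAtAC.h324` ∕ `…CoreLTAt.h324` at the free letter.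
(Part 7 at the re-indexed precision `reindex e e T`, kernel its zero-extended inverse, presentation `Φ ∘ (z ↦ z ∘ e)`; seat n08-b's kit supplies the three member rows, the
Gaussian bridge and the box identity.) [cite: Balaban1985UV3, (22) p.261 + (58) p.270 + p.271; Balaban1982Higgs1, (3.24) p.616; BenfattoEtAl1978, §1 p.144 + Lemma p.152 (class form; ours);
Balaban1985BackgroundPropagators, Sect. E p.428] -/
theorem exists_threshold_h324Row_freeLetter_of_indexedPresentation_allSteps_ae (hd : 0 < d) {γA KT κT C₁ C₀ : ℝ} (hγA0 : 0 < γA)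
    (hKT : 0 ≤ KT) (hκT : 0 < κT) (hC₁ : 0 < C₁)
    (D : ℕ) {ϰ : ℝ} (hϰ : 0 < ϰ) {p₀ σ c₀ : ℝ} (hp₀ : 2 / 3 < p₀) (hσ : 0 < σ) (hc₀ : 0 ≤ c₀) (hκσ : 6 + 2 * 𝔠.κ₀ < σ * (𝔠.nbar + 1)) :
    ∃ b₁ : ℝ, ∀ b₀ : ℝ, b₁ < b₀ → ∃ C : ℝ, 0 ≤ C ∧
      ∀ (S : Scales L) (𝔖 : ∀ k, StepSeries S G ↥(lieC 𝔊) (nblkOf S 𝔠.lane.carrier k) k) (k : ℕ), k ≤ S.K → ∀ (v : ℝ), C * v ≤ 𝔠.Ca + 𝔠.Cc →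
        ∀ {ι : Type} [DecidableEq ι] (B : Hist S.P (k + 1) → GaugeField S.P (k + 1) G → Finset ι)
          (T : ∀ h U, Matrix ↥(B h U) ↥(B h U) ℝ) (ρ : ∀ h U, ↥(B h U) → ↥(B h U) → ℝ)
          (Λ : Hist S.P (k + 1) → GaugeField S.P (k + 1) G → Finset (Fin d → ℤ)) (e : ∀ h U, ↥(B h U) ≃ ↥(Λ h U))
          (Φ : ∀ h U, (↥(B h U) → ℝ) → (𝔖 k).Fl) (H : ∀ h U, (↥(B h U) → ℝ) → ℝ)
          (s : ℕ) (J : Hist S.P (k + 1) → GaugeField S.P (k + 1) G → Finset (Fin d → ℤ))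
          (a : Hist S.P (k + 1) → GaugeField S.P (k + 1) G → Coef d),
          -- the member in INDEX letters: the precision `T` of the block's own variables `B h U`, symmetric, `γ_A`-coercive, decaying in a pseudo-distance `ρ`
          (∀ h U, (B h U).Nonempty) → (∀ h U b b', T h U b b' = T h U b' b) →
          (∀ h U (x : ↥(B h U) → ℝ), γA * ∑ b, x b ^ 2 ≤ ∑ b, ∑ b', T h U b b' * x b * x b') →
          (∀ h U b b', |T h U b b'| ≤ KT * Real.exp (-(κT * ρ h U b b'))) →
          -- the window: a bijection onto `Λ h U ⊂ ℤ^d` distorting `ρ` one-sidedly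
          (∀ h U b b', Real.sqrt (∑ j, (((((e h U b : ↥(Λ h U)) : Fin d → ℤ) j : ℝ) - (((e h U b' : ↥(Λ h U)) : Fin d → ℤ) j : ℝ))) ^ 2) ≤
            C₁ * ρ h U b b' + C₀) →
          -- the a.e. presentation in INDEX letters
          (∀ h U, Measurable (Φ h U)) →
          (∀ h U, (𝔖 k).μ = (gaussianFieldOfKernel fun b b' => ((T h U)⁻¹ : Matrix ↥(B h U) ↥(B h U) ℝ) b b').map (Φ h U)) →
          (∀ h, MeasurableSet ((𝔖 k).box h)) → (∀ h U, Measurable ((𝔖 k).𝒱 h U)) →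
          (∀ h U, Φ h U ⁻¹' (𝔖 k).box h =ᵐ[gaussianFieldOfKernel fun b b' => ((T h U)⁻¹ : Matrix ↥(B h U) ↥(B h U) ℝ) b b']
            {ω | ∀ b, |ω b| ≤ B10.pFun b₀ p₀ (S.gk k)}) →
          (∀ h U, (fun ω => (𝔖 k).𝒱 h U (Φ h U ω)) =ᵐ[gaussianFieldOfKernel fun b b' => ((T h U)⁻¹ : Matrix ↥(B h U) ↥(B h U) ℝ) b b'] H h U) →
          -- the Hamiltonian letters (class II): `H` is a (4.5)-polynomial on the window read through `e`
          (∀ h U (z : (Fin d → ℤ) → ℝ), H h U (fun b => z ((e h U b : ↥(Λ h U)) : Fin d → ℤ)) = hamiltonian s D ϰ (a h U) (J h U) z) →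
          (∀ h U, J h U ⊆ Λ h U) → (∀ h U, coefSup s D (a h U) (J h U) ≤ c₀ * S.gk k ^ σ) → (∀ h U, ((Λ h U).card : ℝ) ≤ v * S.sites k) →
          ∀ h (U : GaugeField S.P (k + 1) G),
            Eq324 (∫ ω in (𝔖 k).box h, Real.exp ((𝔖 k).𝒱 h U ω) ∂(𝔖 k).μ)
              (fun n => cumulantOf (fun m => ∫ ω, (𝔖 k).𝒱 h U ω ^ m ∂(𝔖 k).μ) n) 𝔠.nbar (𝔠.Ca + 𝔠.Cc)
              ((L : ℝ) ^ k * S.g0sq) (3 + 𝔠.κ₀) (S.sites k) := by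
  obtain ⟨b₁, hb₁⟩ := exists_threshold_h324Row_freeLetter_of_expDecayPresentation_allSteps_ae 𝔊 𝔠 hd hγA0
    (KA := KT * Real.exp (κT * C₀ / C₁)) (κA := κT / C₁) (by positivity) (div_pos hκT hC₁) D hϰ hp₀ hσ hc₀ hκσ
  refine ⟨b₁, fun b₀ hb => ?_⟩
  obtain ⟨C, hC, hEND⟩ := hb₁ b₀ hb
  refine ⟨C, hC, ?_⟩
  intro S 𝔖 k hk v hCv ι _ B T ρ Λ e Φ H s J a hB hTs hγ hdec hD hΦ hμ hboxm hVm hbox hV hH hJΛ hA hΛv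
  -- the window-side objects: precision `A h U = reindex e e T`, its zero-extended inverse kernel, the composite presentation `Φ ∘ (z ↦ z ∘ e)`
  refine hEND S 𝔖 k hk v hCv Λ (fun h U => Matrix.reindex (e h U) (e h U) (T h U))
    (fun h U x y => if hxy : x ∈ Λ h U ∧ y ∈ Λ h U then
      ((Matrix.reindex (e h U) (e h U) (T h U))⁻¹ : Matrix ↥(Λ h U) ↥(Λ h U) ℝ) ⟨x, hxy.1⟩ ⟨y, hxy.2⟩ else 0)
    (fun h U z => Φ h U (fun b => z ((e h U b : ↥(Λ h U)) : Fin d → ℤ))) s Λ J a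
    (fun h U x y => rfl) (fun h U => ?_) (fun h U => reindex_symm (e h U) (hTs h U)) (fun h U => reindex_coercive (e h U) (hγ h U))
    (fun h U => reindex_abs_le_exp_of_dist_le (e h U) hKT hκT.le hC₁ (hdec h U) (hD h U))
    (fun h U => (hΦ h U).comp (measurable_restrictAlong (e h U))) (fun h U => ?_) hboxm hVm (fun h U => ?_) (fun h U => ?_)
    (fun h U => ?_) (fun h U => hJΛ h U) hJΛ hA hΛv
  · -- `Λ h U ≠ ∅`
    obtain ⟨b, hb⟩ := hB h U
    exact ⟨_, (e h U ⟨b, hb⟩).2⟩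
  · -- `(𝔖 k).μ = μ_K.map (Φ ∘ restrictAlong e)`
    rw [hμ h U, ← map_restrictAlong_eq (e h U) (fun x y => rfl) (hTs h U) hγA0 (hγ h U),
      Measure.map_map (hΦ h U) (measurable_restrictAlong (e h U))]
    rfl
  · -- the box, a.e.
    have hq : Measure.QuasiMeasurePreserving (fun (z : (Fin d → ℤ) → ℝ) (b : ↥(B h U)) => z ((e h U b : ↥(Λ h U)) : Fin d → ℤ))
        (gaussianFieldOfKernel fun x y => if hxy : x ∈ Λ h U ∧ y ∈ Λ h U then
          ((Matrix.reindex (e h U) (e h U) (T h U))⁻¹ : Matrix ↥(Λ h U) ↥(Λ h U) ℝ) ⟨x, hxy.1⟩ ⟨y, hxy.2⟩ else 0)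
        (gaussianFieldOfKernel fun b b' => ((T h U)⁻¹ : Matrix ↥(B h U) ↥(B h U) ℝ) b b') :=
      ⟨measurable_restrictAlong (e h U), by rw [map_restrictAlong_eq (e h U) (fun x y => rfl) (hTs h U) hγA0 (hγ h U)]⟩
    have h1 := hq.preimage_ae_eq (hbox h U)
    rw [← Set.preimage_comp] at h1
    haveI : Nonempty ↥(B h U) := (hB h U).coe_sort
    exact h1.trans (preimage_box_ae_eq_smallFieldSet_all (e h U) (hTs h U) hγA0 (hγ h U) _)
  · -- the potential, a.e.
    have h1 := ae_eq_comp (g := fun ω => (𝔖 k).𝒱 h U (Φ h U ω)) (g' := H h U) (measurable_restrictAlong (e h U)).aemeasurable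
      (μ := gaussianFieldOfKernel fun x y => if hxy : x ∈ Λ h U ∧ y ∈ Λ h U then
          ((Matrix.reindex (e h U) (e h U) (T h U))⁻¹ : Matrix ↥(Λ h U) ↥(Λ h U) ℝ) ⟨x, hxy.1⟩ ⟨y, hxy.2⟩ else 0)
      (by rw [map_restrictAlong_eq (e h U) (fun x y => rfl) (hTs h U) hγA0 (hγ h U)]; exact hV h U)
    refine h1.trans (Filter.EventuallyEq.of_eq ?_)
    funext z
    exact hH h U z
  · -- `I h U = Λ h U ≠ ∅`
    obtain ⟨b, hb⟩ := hB h U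
    exact ⟨_, (e h U ⟨b, hb⟩).2⟩

/-! ## §3 TORUS LETTERS: variables on the unit torus with labels, decay in the torus metric (seat n08-b's bent window) -/

/-- ★★★ **THE (3.24) ROW AT EVERY RUN STEP FROM A PRESENTATION BY `𝒩(0, T⁻¹)` ON TORUS-INDEXED VARIABLES.**  Scalars `γ_A > 0`, `K_T ≥ 0`, `κ_T > 0`, torus dimension
`d_T ≥ 1`, `m` labels; `∃ b₁, ∀ b₀ > b₁, ∃ C ≥ 0, ∀ S 𝔖, ∀ k ≤ K, ∀ v` (`C·v ≤ Ca + Cc`): for every per-(h,U) variable set `B h U` placed on `(ℤ∕N)^{d_T}` by `site` with labels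
`lab` (`(site, lab)` injective — bond direction × colour), precision `T h U` symmetric, `γ_A`-coercive, `|T b b′| ≤ K_T e^{−κ_T ρ(b,b′)}` with `ρ` dominating the torus
sup-distance of the sites, THERE ARE a window `Λ h U ⊂ ℤ^{2d_T+1}` and a bijection `e h U` (seat n08-b's kit, chosen per `(h,U)`) such that every measurable
`Φ h U : (B h U → ℝ) → Fl` with `(𝔖 k).μ = 𝒩(0,T⁻¹).map Φ`, `Φ⁻¹'box =ᵐ {|ω_b| ≤ p(g_k) ∀ b}`, `𝒱 ∘ Φ =ᵐ H`, Hamiltonian letters `H (z ∘ e) = H^a_J z` on the bent window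
(`J ⊆ Λ`, `sup|coeff| ≤ c₀ g_k^σ`) and `|B h U| ≤ v·|T₁^{(k)}|` gives the row `h324` at the free letter — [Balaban1985UV3]'s block in its native index letters, N06's rows in
the torus metric. [cite: Balaban1985UV3, (18) p.260 + (22) p.261 + (58) p.270 + p.271; Balaban1982Higgs1, (3.24) p.616; BenfattoEtAl1978, Lemma p.152 (class form; ours);
Balaban1985BackgroundPropagators, Sect. E p.428 «a uniform exponential decay»] -/
theorem exists_threshold_h324Row_freeLetter_of_torusBlockPresentation_allSteps_ae {dT : ℕ} (hdT : 0 < dT) (m : ℕ) {γA KT κT : ℝ}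
    (hγA0 : 0 < γA) (hKT : 0 ≤ KT) (hκT : 0 < κT)
    (D : ℕ) {ϰ : ℝ} (hϰ : 0 < ϰ) {p₀ σ c₀ : ℝ} (hp₀ : 2 / 3 < p₀) (hσ : 0 < σ) (hc₀ : 0 ≤ c₀) (hκσ : 6 + 2 * 𝔠.κ₀ < σ * (𝔠.nbar + 1)) :
    ∃ b₁ : ℝ, ∀ b₀ : ℝ, b₁ < b₀ → ∃ C : ℝ, 0 ≤ C ∧
      ∀ (S : Scales L) (𝔖 : ∀ k, StepSeries S G ↥(lieC 𝔊) (nblkOf S 𝔠.lane.carrier k) k) (k : ℕ), k ≤ S.K → ∀ (v : ℝ), C * v ≤ 𝔠.Ca + 𝔠.Cc →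
        ∀ {ι : Type} [DecidableEq ι] {N : ℕ} [NeZero N] (B : Hist S.P (k + 1) → GaugeField S.P (k + 1) G → Finset ι)
          (site : ∀ h U, ↥(B h U) → Fin dT → ZMod N) (lab : ∀ h U, ↥(B h U) → Fin m)
          (T : ∀ h U, Matrix ↥(B h U) ↥(B h U) ℝ) (ρ : ∀ h U, ↥(B h U) → ↥(B h U) → ℝ),
          -- the member in TORUS letters: variables `B h U` placed on the torus `(ℤ/N)^{dT}` with labels, precision `T` symmetric, `γ_A`-coercive, torus-metric decay
          (∀ h U, (B h U).Nonempty) → (∀ h U, Function.Injective fun b => (site h U b, lab h U b)) →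
          (∀ h U b b', T h U b b' = T h U b' b) →
          (∀ h U (x : ↥(B h U) → ℝ), γA * ∑ b, x b ^ 2 ≤ ∑ b, ∑ b', T h U b b' * x b * x b') →
          (∀ h U b b', |T h U b b'| ≤ KT * Real.exp (-(κT * ρ h U b b'))) →
          (∀ h U b b' i, (|((site h U b i - site h U b' i).valMinAbs : ℤ)| : ℝ) ≤ ρ h U b b') →
        ∃ (Λ : Hist S.P (k + 1) → GaugeField S.P (k + 1) G → Finset (Fin (dT + dT + 1) → ℤ)) (e : ∀ h U, ↥(B h U) ≃ ↥(Λ h U)),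
        ∀ (Φ : ∀ h U, (↥(B h U) → ℝ) → (𝔖 k).Fl) (H : ∀ h U, (↥(B h U) → ℝ) → ℝ)
          (s : ℕ) (J : Hist S.P (k + 1) → GaugeField S.P (k + 1) G → Finset (Fin (dT + dT + 1) → ℤ))
          (a : Hist S.P (k + 1) → GaugeField S.P (k + 1) G → Coef (dT + dT + 1)),
          -- the a.e. presentation in INDEX letters
          (∀ h U, Measurable (Φ h U)) →
          (∀ h U, (𝔖 k).μ = (gaussianFieldOfKernel fun b b' => ((T h U)⁻¹ : Matrix ↥(B h U) ↥(B h U) ℝ) b b').map (Φ h U)) →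
          (∀ h, MeasurableSet ((𝔖 k).box h)) → (∀ h U, Measurable ((𝔖 k).𝒱 h U)) →
          (∀ h U, Φ h U ⁻¹' (𝔖 k).box h =ᵐ[gaussianFieldOfKernel fun b b' => ((T h U)⁻¹ : Matrix ↥(B h U) ↥(B h U) ℝ) b b']
            {ω | ∀ b, |ω b| ≤ B10.pFun b₀ p₀ (S.gk k)}) →
          (∀ h U, (fun ω => (𝔖 k).𝒱 h U (Φ h U ω)) =ᵐ[gaussianFieldOfKernel fun b b' => ((T h U)⁻¹ : Matrix ↥(B h U) ↥(B h U) ℝ) b b'] H h U) →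
          -- the Hamiltonian letters on the bent window (class II)
          (∀ h U (z : (Fin (dT + dT + 1) → ℤ) → ℝ), H h U (fun b => z ((e h U b : ↥(Λ h U)) : Fin (dT + dT + 1) → ℤ)) = hamiltonian s D ϰ (a h U) (J h U) z) →
          (∀ h U, J h U ⊆ Λ h U) → (∀ h U, coefSup s D (a h U) (J h U) ≤ c₀ * S.gk k ^ σ) → (∀ h U, ((B h U).card : ℝ) ≤ v * S.sites k) →
          ∀ h (U : GaugeField S.P (k + 1) G),
            Eq324 (∫ ω in (𝔖 k).box h, Real.exp ((𝔖 k).𝒱 h U ω) ∂(𝔖 k).μ)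
              (fun n => cumulantOf (fun m => ∫ ω, (𝔖 k).𝒱 h U ω ^ m ∂(𝔖 k).μ) n) 𝔠.nbar (𝔠.Ca + 𝔠.Cc)
              ((L : ℝ) ^ k * S.g0sq) (3 + 𝔠.κ₀) (S.sites k) := by
  have hd : 0 < dT + dT + 1 := Nat.succ_pos _
  obtain ⟨b₁, hb₁⟩ := exists_threshold_h324Row_freeLetter_of_expDecayPresentation_allSteps_ae 𝔊 𝔠 hd hγA0
    (KA := KT * Real.exp (κT * m)) (κA := κT / Real.sqrt (dT + dT + 1)) (by positivity) (div_pos hκT (Real.sqrt_pos.2 (by positivity)))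
    D hϰ hp₀ hσ hc₀ hκσ
  refine ⟨b₁, fun b₀ hb => ?_⟩
  obtain ⟨C, hC, hEND⟩ := hb₁ b₀ hb
  refine ⟨C, hC, ?_⟩
  intro S 𝔖 k hk v hCv ι _ N _ B site lab T ρ hB hinj hTs hγ hdec hρ
  -- the bent window and the bijection, per `(h, U)` (seat n08-b's torus member kit)
  have hkit := fun h U => exists_presentation_of_torusDecay dT N m hdT (site h U) (lab h U) (hinj h U) (hTs h U) hγA0 (hγ h U) hKT hκT.le
    (hdec h U) (hρ h U)
  choose Λ e hsymm hcoer hdecay hbridge hboxkit using hkit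
  refine ⟨Λ, e, ?_⟩
  intro Φ H s J a hΦ hμ hboxm hVm hbox hV hH hJΛ hA hBv
  refine hEND S 𝔖 k hk v hCv Λ (fun h U => Matrix.reindex (e h U) (e h U) (T h U))
    (fun h U x y => if hxy : x ∈ Λ h U ∧ y ∈ Λ h U then
      ((Matrix.reindex (e h U) (e h U) (T h U))⁻¹ : Matrix ↥(Λ h U) ↥(Λ h U) ℝ) ⟨x, hxy.1⟩ ⟨y, hxy.2⟩ else 0)
    (fun h U z => Φ h U (fun b => z ((e h U b : ↥(Λ h U)) : Fin (dT + dT + 1) → ℤ))) s Λ J a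
    (fun h U x y => rfl) (fun h U => ?_) hsymm hcoer hdecay
    (fun h U => (hΦ h U).comp (measurable_restrictAlong (e h U))) (fun h U => ?_) hboxm hVm (fun h U => ?_) (fun h U => ?_)
    (fun h U => ?_) (fun h U => hJΛ h U) hJΛ hA (fun h U => ?_)
  · obtain ⟨b, hb⟩ := hB h U
    exact ⟨_, (e h U ⟨b, hb⟩).2⟩
  · rw [hμ h U, ← hbridge h U, Measure.map_map (hΦ h U) (measurable_restrictAlong (e h U))]
    rfl
  · have hq : Measure.QuasiMeasurePreserving (fun (z : (Fin (dT + dT + 1) → ℤ) → ℝ) (b : ↥(B h U)) => z ((e h U b : ↥(Λ h U)) : Fin (dT + dT + 1) → ℤ))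
        (gaussianFieldOfKernel fun x y => if hxy : x ∈ Λ h U ∧ y ∈ Λ h U then
          ((Matrix.reindex (e h U) (e h U) (T h U))⁻¹ : Matrix ↥(Λ h U) ↥(Λ h U) ℝ) ⟨x, hxy.1⟩ ⟨y, hxy.2⟩ else 0)
        (gaussianFieldOfKernel fun b b' => ((T h U)⁻¹ : Matrix ↥(B h U) ↥(B h U) ℝ) b b') :=
      ⟨measurable_restrictAlong (e h U), by rw [hbridge h U]⟩
    have h1 := hq.preimage_ae_eq (hbox h U)
    rw [← Set.preimage_comp] at h1
    haveI : Nonempty ↥(B h U) := (hB h U).coe_sort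
    exact h1.trans (preimage_box_ae_eq_smallFieldSet_of_nonneg (e h U) _ (hboxkit h U) _)
  · have h1 := ae_eq_comp (g := fun ω => (𝔖 k).𝒱 h U (Φ h U ω)) (g' := H h U) (measurable_restrictAlong (e h U)).aemeasurable
      (μ := gaussianFieldOfKernel fun x y => if hxy : x ∈ Λ h U ∧ y ∈ Λ h U then
          ((Matrix.reindex (e h U) (e h U) (T h U))⁻¹ : Matrix ↥(Λ h U) ↥(Λ h U) ℝ) ⟨x, hxy.1⟩ ⟨y, hxy.2⟩ else 0)
      (by rw [hbridge h U]; exact hV h U)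
    refine h1.trans (Filter.EventuallyEq.of_eq ?_)
    funext z
    exact hH h U z
  · obtain ⟨b, hb⟩ := hB h U
    exact ⟨_, (e h U ⟨b, hb⟩).2⟩
  · -- `|Λ h U| = |B h U| ≤ v·|T₁^{(k)}|`
    have : (Λ h U).card = (B h U).card := by
      rw [← Fintype.card_coe, ← Fintype.card_coe]; exact (Fintype.card_congr (e h U)).symm
    rw [this]; exact hBv h U

end Summit.QuantumFields.YangMills.Theorems.BalabanUVNodesN08AlphaEq324RowClassSocketEndIndexed

end
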